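import Mathlib
import Summits.KontsevichZagierPeriods.Zeta5Search.CasoratianClassBoundShift
import HarnessLib

/-!
# ζ(5) search — the shift rule for the unit `ĝ_q` under `b ↦ b + e_j` (gen-2 g9's G3), exact

Cell `pub-zeta5` (HONEST FRAMING: systematic search; no irrationality claim unless certified), P1 prover seat
generation 5.  gen-2 g9 (REPORT-gen2-g9 §1.4, statement `GHatShift` of the staged `G9UniversalDigit.lean`, exact check 7,513
classes): if neither moved point `b_j`, `b₀ − b_j` of the contiguous shift `b ↦ b + e_j` lies in the residue class of the pole `q`,
then **`ĝ_q(b + e_j) = ĝ_q(b)·(b_j − q)·(b₀ − b_j − q)`** — the block `[b_j, b₀−b_j]` shrinks to `[b_j+1, b₀−b_j−1]`, so the net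
exponent rises by one exactly at the two (distinct) moved points (`netExp_shift_eq`) and the two new linear factors are foreign to
the class.  Proved here with literally gen-2's statement body (`gHat_shift`).  This is the `ĝ`-half of the mechanism by which the
first Casoratian digit factorises ("row digit = λ·V-digit", λ = (b_j − x)(b₀ − b_j − x)); identities of rational numbers, nothing
about irrationality.
-/

noncomputable section

open Finset

namespace Summit.KontsevichZagierPeriods.Zeta5Search.CellA

open Summit.KontsevichZagierPeriods.Zeta5Search.DualSeries (InBox)
open Summit.KontsevichZagierPeriods.Zeta5Search.CasoratianValuation (InPolytope shift)
open Summit.KontsevichZagierPeriods.Zeta5Search.ClusterValuation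
open Summit.KontsevichZagierPeriods.Zeta5Search.BigPrime (block shift_zero)

/-! ### The depth under the shift, exactly -/

/-- The shrunken block: `[β+1, N−β−1] = [β, N−β] ∖ {β, N−β}`. -/
theorem mem_block_succ_iff (N β s : ℕ) : s ∈ block N (β + 1) ↔ s ∈ block N β ∧ s ≠ β ∧ s ≠ N - β := by
  simp only [block, mem_Icc]; omega

/-- **Exact depth under the shift**: `blockCount (b+e_j) s + [s ∈ {b_j, b₀−b_j}] = blockCount b s` (the two moved points are
distinct and lie in the old block as soon as `2b_j ≤ b₀`). -/
theorem blockCount_shift_eq (b : ℕ → ℤ) (hb : InBox b) {j : ℕ} (hj1 : 1 ≤ j) (hj7 : j ≤ 7) (h2 : 2 * b j ≤ b 0) (s : ℕ) :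
    blockCount (shift b j) s + (if s = (b j).toNat ∨ s = (b 0).toNat - (b j).toNat then 1 else 0) = blockCount b s := by
  have hβ0 : 0 ≤ b j := by have := (hb.2 (j - 1) (mem_range.2 (by omega))).1; rwa [show j - 1 + 1 = j by omega] at this
  have hN0 : 0 ≤ b 0 := hb.1
  set β := (b j).toNat with hβ
  set N := (b 0).toNat with hN
  have hβN : 2 * β ≤ N := by omega
  -- split off the index `j - 1` from both filters
  unfold blockCount
  rw [shift_zero b hj1]
  have hjm : j - 1 ∈ range 7 := mem_range.2 (by omega)
  have hval : ∀ i ∈ range 7, i ≠ j - 1 → shift b j (i + 1) = b (i + 1) := fun i _ hi => by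
    simp [shift, Function.update_of_ne (show i + 1 ≠ j by omega)]
  have hvj : shift b j (j - 1 + 1) = b j + 1 := by rw [show j - 1 + 1 = j by omega]; simp [shift]
  rw [← Finset.card_filter_add_card_filter_not (s := (range 7).filter fun i =>
      s ∈ block (b 0).toNat (shift b j (i + 1)).toNat) (fun i => i = j - 1),
    ← Finset.card_filter_add_card_filter_not (s := (range 7).filter fun i =>
      s ∈ block (b 0).toNat (b (i + 1)).toNat) (fun i => i = j - 1)]
  have hrest : ((range 7).filter fun i => s ∈ block (b 0).toNat (shift b j (i + 1)).toNat).filter (fun i => ¬ i = j - 1) =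
      ((range 7).filter fun i => s ∈ block (b 0).toNat (b (i + 1)).toNat).filter (fun i => ¬ i = j - 1) := by
    ext i
    simp only [mem_filter, mem_range]
    constructor
    · rintro ⟨⟨hi, hs⟩, hne⟩; exact ⟨⟨hi, by rwa [hval i (mem_range.2 hi) hne] at hs⟩, hne⟩
    · rintro ⟨⟨hi, hs⟩, hne⟩; exact ⟨⟨hi, by rwa [hval i (mem_range.2 hi) hne]⟩, hne⟩
  rw [hrest]
  -- the index `j - 1` itself
  have hone : ∀ (P : ℕ → Prop) [DecidablePred P],
      (((range 7).filter P).filter (fun i => i = j - 1)).card = if P (j - 1) then 1 else 0 := by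
    intro P _
    have : ((range 7).filter P).filter (fun i => i = j - 1) = if P (j - 1) then {j - 1} else ∅ := by
      ext i; simp only [mem_filter, mem_range]
      split_ifs with h
      · simp only [mem_singleton]; constructor
        · rintro ⟨-, rfl⟩; rfl
        · rintro rfl; exact ⟨⟨by omega, h⟩, rfl⟩
      · simp only [notMem_empty, iff_false, not_and]; rintro ⟨-, hP⟩ rfl; exact h hP
    rw [this]; split_ifs <;> simp
  rw [hone, hone, hvj, show j - 1 + 1 = j by omega]
  have hβ1 : (b j + 1).toNat = β + 1 := by omega
  rw [hβ1]
  by_cases hs : s ∈ block N β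
  · rw [if_pos hs]
    by_cases hend : s = β ∨ s = N - β
    · have : ¬ s ∈ block N (β + 1) := by rw [mem_block_succ_iff]; tauto
      rw [if_neg this, if_pos hend]; ring
    · have : s ∈ block N (β + 1) := by rw [mem_block_succ_iff]; push Not at hend; exact ⟨hs, hend.1, hend.2⟩
      rw [if_pos this, if_neg hend, add_zero]
  · rw [if_neg hs]
    have h1 : ¬ s ∈ block N (β + 1) := fun h => hs ((mem_block_succ_iff N β s).1 h).1
    have h2 : ¬ (s = β ∨ s = N - β) := by
      rintro (rfl | rfl) <;> apply hs <;> simp only [block, mem_Icc] <;> omega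
    rw [if_neg h1, if_neg h2, add_zero]

/-- **Exact net exponent under the shift**: `netExp (b+e_j) s = netExp b s + [s ∈ {b_j, b₀−b_j}]`. -/
theorem netExp_shift_eq (b : ℕ → ℤ) (hb : InBox b) {j : ℕ} (hj1 : 1 ≤ j) (hj7 : j ≤ 7) (h2 : 2 * b j ≤ b 0) (s : ℕ) :
    netExp (shift b j) s = netExp b s + (if s = (b j).toNat ∨ s = (b 0).toNat - (b j).toNat then 1 else 0) := by
  have h := blockCount_shift_eq b hb hj1 hj7 h2 s
  unfold netExp
  rw [shift_zero b hj1]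
  split_ifs at h ⊢ <;> omega

/-! ### G3 -/

/-- **G3 (gen-2 g9, `GHatShift`)**: the unit `ĝ_q` under the shift `b ↦ b + e_j`, exactly. -/
theorem gHat_shift : ∀ (b : ℕ → ℤ) (p x q j : ℕ), InPolytope b → 1 ≤ j → j ≤ 7 → InPolytope (shift b j) → p.Prime → 5 ≤ p →
    x < p → q ∈ classSet b p x → (b j).toNat ∉ classSet b p x → (b 0 - b j).toNat ∉ classSet b p x →
      gHat (shift b j) p q = gHat b p q * ((b j : ℚ) - q) * (((b 0 - b j : ℤ) : ℚ) - q) := by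
  intro b p x q j hb hj1 hj7 hb' hprime hp5 hx hq hβ hNβ
  have hbox : InBox b := hb.1
  have hβ0 : 0 ≤ b j := by
    have := (hbox.2 (j - 1) (mem_range.2 (by omega))).1; rwa [show j - 1 + 1 = j by omega] at this
  have hN0 : 0 ≤ b 0 := hbox.1
  have h2' : 2 * shift b j j ≤ shift b j 0 := by
    have := hb'.2.1 (j - 1) (mem_range.2 (by omega)); rwa [show j - 1 + 1 = j by omega] at this
  have h2 : 2 * b j + 2 ≤ b 0 := by
    rw [shift_zero b hj1] at h2'; simp [shift] at h2'; linarith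
  set β := (b j).toNat with hβdef
  set N := (b 0).toNat with hNdef
  have hβq : (b j : ℚ) = (β : ℚ) := by
    have : (b j : ℤ) = (β : ℤ) := (Int.toNat_of_nonneg hβ0).symm
    exact_mod_cast this
  have hNβq : ((b 0 - b j : ℤ) : ℚ) = ((N - β : ℕ) : ℚ) := by
    have : (b 0 - b j : ℤ) = ((N - β : ℕ) : ℤ) := by omega
    exact_mod_cast this
  have hNβ' : (b 0 - b j).toNat = N - β := by omega
  rw [hNβ'] at hNβ
  -- the class data
  have hqx : q % p = x % p := (mem_filter.1 hq).2
  have hnot : ∀ s, s ≤ N → s ∉ classSet b p x → s % p ≠ q % p := by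
    intro s hs hs' heq
    exact hs' (mem_filter.2 ⟨mem_range.2 (by omega), heq.trans hqx⟩)
  have hβN : β ≤ N := by omega
  have hβmod : β % p ≠ q % p := hnot β hβN hβ
  have hNβmod : (N - β) % p ≠ q % p := hnot (N - β) (by omega) hNβ
  have hne : β ≠ N - β := by omega
  -- rewrite both `gHat`s
  unfold gHat
  rw [shift_zero b hj1]
  have hcen : (if ¬ (2 : ℤ) ∣ b 0 ∧ ¬ CentreIn (shift b j) p q then (b 0 : ℚ) / 2 - q else 1) =
      (if ¬ (2 : ℤ) ∣ b 0 ∧ ¬ CentreIn b p q then (b 0 : ℚ) / 2 - q else 1) := by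
    have : CentreIn (shift b j) p q ↔ CentreIn b p q := by unfold CentreIn; rw [shift_zero b hj1]
    simp only [this]
  rw [hcen]
  set S := (range (N + 1)).filter (fun s => s % p ≠ q % p) with hS
  have hprod : ∏ s ∈ S, ((s : ℚ) - q) ^ netExp (shift b j) s =
      (∏ s ∈ S, ((s : ℚ) - q) ^ netExp b s) * (((β : ℚ) - q) * (((N - β : ℕ) : ℚ) - q)) := by
    have hmemβ : β ∈ S := mem_filter.2 ⟨mem_range.2 (by omega), hβmod⟩
    have hmemNβ : N - β ∈ S.erase β := mem_erase.2 ⟨hne.symm, mem_filter.2 ⟨mem_range.2 (by omega), hNβmod⟩⟩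
    rw [← mul_prod_erase S _ hmemβ, ← mul_prod_erase _ _ hmemNβ, ← mul_prod_erase S _ hmemβ,
      ← mul_prod_erase _ _ hmemNβ]
    have hrest : ∀ s ∈ (S.erase β).erase (N - β), netExp (shift b j) s = netExp b s := by
      intro s hs
      have h1 := (mem_erase.1 hs).1
      have h2 := (mem_erase.1 (mem_erase.1 hs).2).1
      rw [netExp_shift_eq b hbox hj1 hj7 (by omega) s, if_neg (by rw [← hβdef, ← hNdef]; push Not; exact ⟨h2, h1⟩)]
      ring
    rw [prod_congr rfl fun s hs => by rw [hrest s hs]]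
    have eβ : netExp (shift b j) β = netExp b β + 1 := by
      rw [netExp_shift_eq b hbox hj1 hj7 (by omega) β, if_pos (Or.inl hβdef.symm.symm)]
    have eNβ : netExp (shift b j) (N - β) = netExp b (N - β) + 1 := by
      rw [netExp_shift_eq b hbox hj1 hj7 (by omega) (N - β), if_pos (Or.inr (by rw [← hβdef, ← hNdef]))]
    have hzβ : ((β : ℚ) - q) ≠ 0 := sub_ne_zero.2 (by
      intro h; apply hβmod; have : β = q := by exact_mod_cast h
      rw [this])
    have hzNβ : (((N - β : ℕ) : ℚ) - q) ≠ 0 := sub_ne_zero.2 (by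
      intro h; apply hNβmod; have : N - β = q := by exact_mod_cast h
      rw [this])
    rw [eβ, eNβ, zpow_add_one₀ hzβ, zpow_add_one₀ hzNβ]
    ring
  rw [hprod, hβq, hNβq]
  ring

end Summit.KontsevichZagierPeriods.Zeta5Search.CellA

end
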